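import Literature.Probability.RandomPlanarGeometry.HexSAWSurfaceWallRenewalKestenHeadSeven
import Literature.Probability.RandomPlanarGeometry.HexSAWSurfaceWallRenewalSeventhFloor
import HarnessLib

/-!
# The seventh-order coefficient of `β(y)²` is exactly twelve:
# `y⁶ (β(y)² − y − 1/y − 1/y² − 2/y³ − 4/y⁴ − 6/y⁵) → 12`

`β(y) = wallRate y` is the exponential growth rate of wall bridges of self-avoiding walks on the brick-wall (hexagonal) lattice along a
zigzag wall with contact fugacity `y` («WALL-BRIDGES»).  The tree knows the strong-adsorption expansion
`β(y)² = y + 1/y + 1/y² + 2/y³ + 4/y⁴ + 6/y⁵ + o(y⁻⁵)` with every coefficient EXACT («SECOND-ORDER-SHARP», …, «SIXTH-LOWER»), and the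
one-sided seventh order `liminf y⁶(β² − …− 6/y⁵) ≥ 12` («SEVENTH-FLOOR», `HexSAWSurfaceWallRenewalSeventhFloor`).  This module proves
the MATCHING UPPER BOUND and hence

  ★★★ `tendsto_pow_six_mul_wallRate_sq_sub : y⁶ (β(y)² − y − 1/y − 1/y² − 2/y³ − 4/y⁴ − 6/y⁵) → 12` (`y → ∞`),

i.e. `β(y)² = y + 1/y + 1/y² + 2/y³ + 4/y⁴ + 6/y⁵ + 12/y⁶ + o(y⁻⁶)` (`isLittleO_wallRate_sq_sub_seventh`, `eventually_seventh_order_window`):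
the lane's conjectured `a₆ = 12` (FINDING-HEX-WALL-SEVENTH-ORDER-PREDICTION; census bookkeeping `12 = N₈₁ + N₉₂ + N₁₀,₃ − 67 =
38 + 34 + 7 − 67`) is a theorem.

METHOD (no new enumeration; the inversion announced in «KESTEN-HEAD-SEVEN»).  Write `T(y) := y⁶(β² − y − 1/y − … − 6/y⁵)`, `B = β²`,
`r = y/B`, and let `H₇(y) = y/B + y/B³ + y/B⁴ + 3y/B⁵ + (6y + y²)/B⁶ + (15y + 3y²)/B⁷ + (38y + 11y²)/B⁸ + (34y² + y³)/B⁹ + 7y³/B¹⁰` be the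
order-seven head of Kesten's identity `Σ_s f_s(y) = 1` (the complete census of wall-renewal classes `(s, v)` with `s − v ≤ 7`, cars
63–72 of the lane: 122 blocks, 79 of them on the diagonal `s − v = 7`).  «SEVENTH-FLOOR» rests on the EXACT identity
`T(y) − G(y, r) = y⁶ B (1 − H₇(y))` for an explicit comparison function `G` with `G(y, y/β²) → 12` (orders one to four exact), whence
`T ≥ G` from `H₇ ≤ 1`.  «KESTEN-HEAD-SEVEN» (ed.2) supplies the other side
on `y > μ³ = (2+√2)^{3/2}`: `1 − H₇(y) ≤ τ(y) := A(y)θ₃(y)^{11} + 3^{18}y/β^{18} + 3^{20}(y + y²)/β^{20} + 3^{22}(y + y² + y³)/β^{22}`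
(`θ₃ = μ²/y^{2/3}`, `A = (μ² + y^{2/3}/μ²)θ₃/(1 − θ₃)`; the six-step tail of «KENDALL-CUBE» at `n = 11` plus the crude count
`#ipwb_n ≤ 3^n` on the uncounted classes).  Hence (§1) `T ≤ G + y⁶ B τ`, and (§2) `y⁶ B τ(y) → 0`: with `B ∼ y`,
`y⁷ A θ₃^{11} = μ^{22} A · y^{−1/3} → 0` and `y⁷ · (3^{18}y/β^{18} + …) = 3^{18}r⁹/y + 3^{20}r^{10}(1/y + 1/y²) + 3^{22}r^{11}(1/y + 1/y² + 1/y³) → 0`.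
The squeeze (§3) gives `T → 12`.

CONTENTS. §0 private plumbing (`y/B → 1`, `B/y → 1`, the exponent bookkeeping `(y^{2/3})^{11} = y⁷ · y^{1/3}`) · §1 ★★ `seventh_order_upper_of_cube_lt`
(`T ≤ G + y⁶Bτ` for every `y > μ³`) · §2 ★ `tendsto_pow_seven_mul_envelope_tail`, ★ `tendsto_pow_seven_mul_crude_tail`,
★★ `tendsto_pow_six_mul_sq_wallRate_mul_tail` (`y⁶Bτ → 0`) · §3 ★★★ `tendsto_pow_six_mul_wallRate_sq_sub` (`T → 12`),
★★★ `isLittleO_wallRate_sq_sub_seventh`, ★★ `eventually_seventh_order_window`, ★ `tendsto_pow_six_mul_wallRate_sq_sub_unique`.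

HONEST LABEL.  LANE THEOREM for this model, DERIVED from the landed census chain (cars 63–72: «EXCESS-LIMIT», «EIGHT-UNIQUE», «TEN-THREE»,
«FIFTH-EXACT», «SIXTH-EXACT», «SEVEN-CENSUS»), the six-step law («SIX-STEP», a-idea-1 g33) and Kesten's relation on `y > μ³`
(«RENEWAL-CUBE-RANGE», «KENDALL-CUBE», «KESTEN-HEAD-SEVEN»); the printed sources carry the first-order statement `β ∼ √y` only
([BeatonBousquetMelouDeGierDuminilCopinGuttmann2014, §3.1, Proposition 5 and the remark on p. 10 (arXiv v5)]) and the general renewal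
theory ([MadrasSlade1993, §4.2, (4.2.2), (4.2.4), Theorem 4.2.2 (pp. 91–92)], [Kesten1963SAW, §4]); the coefficient `12` (like
`1, 1, 2, 4, 6` before it) is computed in this lane — NEW IN WRITING (modest), not a quotation.  Consistency: the target constant was
certified beforehand by exact rational arithmetic on the census on three codes (a-p6 g19 `a6_check.py`, lit-1 g26/g27 faces, ref g67's
second; ref g67's COMMENT ERRATUM on `a6_check.py` l.2 — the `O(u⁸)` truncation is justified by the `n = 11` sandwich of
«KESTEN-HEAD-SEVEN» ed.2, not by ed.1's `n = 10` tail — is the reason this file uses `kesten_head_seven_sandwich_sharp_of_cube_lt`).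
NOT CLAIMED: the eighth order (`a₇`; it needs the diagonal `s − v = 8`), any RATE in `o(y⁻⁶)` (the bound of §1 is `O(y^{−1/3})` only,
from the envelope term), `m₇ = 211` / `V₇ = 21` (next car), anything for `y ≤ μ³`, the armchair wall, numerics.  No definitions.
-/

namespace Literature.Probability.RandomPlanarGeometry.SAW.HexBW.Wall

open Finset Filter Function
open Literature.Probability.LatticeModels
open _root_.Topology Asymptotics

variable {y : ℝ}

/-! ### §0  Private plumbing -/

/-- `y/β² → 1` (`β ∼ √y`). [cite: BeatonBousquetMelouDeGierDuminilCopinGuttmann2014, Section 3.1, Proposition 5 (arXiv v5 p. 9)] -/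
private theorem tendsto_div_sq_wallRate_sve : Tendsto (fun y : ℝ => y / wallRate y ^ 2) atTop (𝓝 1) := by
  have h1 : Tendsto (fun y : ℝ => ((wallRate y / Real.sqrt y) ^ 2)⁻¹) atTop (𝓝 ((1 : ℝ) ^ 2)⁻¹) :=
    (tendsto_wallRate_div_sqrt.pow 2).inv₀ (by norm_num)
  rw [one_pow, inv_one] at h1
  refine h1.congr' ?_
  filter_upwards [eventually_gt_atTop (0 : ℝ)] with y hy
  rw [div_pow, Real.sq_sqrt hy.le, inv_div]

/-- `β²/y → 1` (`β ∼ √y`). [cite: BeatonBousquetMelouDeGierDuminilCopinGuttmann2014, Section 3.1, Proposition 5 (arXiv v5 p. 9)] -/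
private theorem tendsto_sq_wallRate_div_sve : Tendsto (fun y : ℝ => wallRate y ^ 2 / y) atTop (𝓝 1) := by
  have h1 : Tendsto (fun y : ℝ => (wallRate y / Real.sqrt y) ^ 2) atTop (𝓝 ((1 : ℝ) ^ 2)) := tendsto_wallRate_div_sqrt.pow 2
  rw [one_pow] at h1
  refine h1.congr' ?_
  filter_upwards [eventually_gt_atTop (0 : ℝ)] with y hy
  rw [div_pow, Real.sq_sqrt hy.le]

/-- [folklore] Exponent bookkeeping: `(y^{2/3})^{11} = y⁷ · y^{1/3}` for `y > 0`. -/
private theorem rpow_two_thirds_pow_eleven_sve (hy : 0 < y) : (y ^ ((2 : ℝ) / 3)) ^ 11 = y ^ 7 * y ^ ((1 : ℝ) / 3) := by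
  rw [← Real.rpow_natCast (y ^ ((2 : ℝ) / 3)) 11, ← Real.rpow_mul hy.le, ← Real.rpow_natCast y 7, ← Real.rpow_add hy]
  norm_num

/-! ### §1  The seventh-order upper bound in closed form on `y > μ³` -/

/-- ★★ **THE SEVENTH-ORDER UPPER BOUND IN CLOSED FORM.**  For `y > μ³`, with `r = y/β(y)²`, `θ₃ = μ²/y^{2/3}`:
`y⁶ (β(y)² − y − 1/y − 1/y² − 2/y³ − 4/y⁴ − 6/y⁵) ≤ G(y, r) + y⁶ β² τ(y)`, where
`G(y, r) = y⁵(r² − 1) + y⁴(r³ − 1) + y³(3r⁴ + r⁵ − 2) + y²(6r⁵ + 3r⁶ − 4) + y(15r⁶ + 11r⁷ + r⁸ − 6) + (38r⁷ + 34r⁸ + 7r⁹)` is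
«SEVENTH-FLOOR»'s comparison function (`→ 12`) and
`τ(y) = (μ² + y^{2/3}/μ²)θ₃/(1 − θ₃) · θ₃^{11} + 3^{18}y/β^{18} + 3^{20}(y + y²)/β^{20} + 3^{22}(y + y² + y³)/β^{22}` is the tail of
«KESTEN-HEAD-SEVEN» ed.2 (the difference of the two sides of «SEVENTH-FLOOR»'s bound is `y⁶β²(1 − H₇) ≤ y⁶β²τ`).
[cite: Kesten1963SAW, Section 4] [cite: MadrasSlade1993, Section 4.2, (4.2.2), (4.2.4), Theorem 4.2.2 (pp. 91–92)] [cite: BeatonBousquetMelouDeGierDuminilCopinGuttmann2014, Section 3.1, Proposition 5 (arXiv v5 p. 9)] -/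
theorem seventh_order_upper_of_cube_lt (hy : hexConnectiveConstant ^ 3 < y) :
    y ^ 6 * (wallRate y ^ 2 - y - 1 / y - 1 / y ^ 2 - 2 / y ^ 3 - 4 / y ^ 4 - 6 / y ^ 5) ≤
      (y ^ 5 * ((y / wallRate y ^ 2) ^ 2 - 1) + y ^ 4 * ((y / wallRate y ^ 2) ^ 3 - 1) +
          y ^ 3 * (3 * (y / wallRate y ^ 2) ^ 4 + (y / wallRate y ^ 2) ^ 5 - 2) +
          y ^ 2 * (6 * (y / wallRate y ^ 2) ^ 5 + 3 * (y / wallRate y ^ 2) ^ 6 - 4) +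
          y * (15 * (y / wallRate y ^ 2) ^ 6 + 11 * (y / wallRate y ^ 2) ^ 7 + (y / wallRate y ^ 2) ^ 8 - 6) +
          (38 * (y / wallRate y ^ 2) ^ 7 + 34 * (y / wallRate y ^ 2) ^ 8 + 7 * (y / wallRate y ^ 2) ^ 9)) +
        y ^ 6 * wallRate y ^ 2 *
          ((hexConnectiveConstant ^ 2 + y ^ ((2 : ℝ) / 3) / hexConnectiveConstant ^ 2) *
                (hexConnectiveConstant ^ 2 / y ^ ((2 : ℝ) / 3)) / (1 - hexConnectiveConstant ^ 2 / y ^ ((2 : ℝ) / 3)) *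
                (hexConnectiveConstant ^ 2 / y ^ ((2 : ℝ) / 3)) ^ 11 +
            (3 ^ 18 * y / wallRate y ^ 18 + (3 ^ 20 * y + 3 ^ 20 * y ^ 2) / wallRate y ^ 20 +
              3 ^ 22 * (y + y ^ 2 + y ^ 3) / wallRate y ^ 22)) := by
  have hμ := hexConnectiveConstant_pos
  have hy0 : 0 < y := lt_of_le_of_lt (by positivity) hy
  have hβ := wallRate_pos y
  have hB : wallRate y ≠ 0 := hβ.ne'
  have hlow := (kesten_head_seven_sandwich_sharp_of_cube_lt hy).1
  set a := (hexConnectiveConstant ^ 2 + y ^ ((2 : ℝ) / 3) / hexConnectiveConstant ^ 2) *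
      (hexConnectiveConstant ^ 2 / y ^ ((2 : ℝ) / 3)) / (1 - hexConnectiveConstant ^ 2 / y ^ ((2 : ℝ) / 3)) *
      (hexConnectiveConstant ^ 2 / y ^ ((2 : ℝ) / 3)) ^ 11 with ha
  set b := 3 ^ 18 * y / wallRate y ^ 18 + (3 ^ 20 * y + 3 ^ 20 * y ^ 2) / wallRate y ^ 20 +
      3 ^ 22 * (y + y ^ 2 + y ^ 3) / wallRate y ^ 22 with hb
  set K := y / wallRate y ^ 2 + y / wallRate y ^ 6 + y / wallRate y ^ 8 + 3 * y / wallRate y ^ 10 +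
      (6 * y + y ^ 2) / wallRate y ^ 12 + (15 * y + 3 * y ^ 2) / wallRate y ^ 14 + (38 * y + 11 * y ^ 2) / wallRate y ^ 16 +
      (34 * y ^ 2 + y ^ 3) / wallRate y ^ 18 + 7 * y ^ 3 / wallRate y ^ 20 with hK
  have key : y ^ 6 * (wallRate y ^ 2 - y - 1 / y - 1 / y ^ 2 - 2 / y ^ 3 - 4 / y ^ 4 - 6 / y ^ 5) -
      (y ^ 5 * ((y / wallRate y ^ 2) ^ 2 - 1) + y ^ 4 * ((y / wallRate y ^ 2) ^ 3 - 1) +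
        y ^ 3 * (3 * (y / wallRate y ^ 2) ^ 4 + (y / wallRate y ^ 2) ^ 5 - 2) +
        y ^ 2 * (6 * (y / wallRate y ^ 2) ^ 5 + 3 * (y / wallRate y ^ 2) ^ 6 - 4) +
        y * (15 * (y / wallRate y ^ 2) ^ 6 + 11 * (y / wallRate y ^ 2) ^ 7 + (y / wallRate y ^ 2) ^ 8 - 6) +
        (38 * (y / wallRate y ^ 2) ^ 7 + 34 * (y / wallRate y ^ 2) ^ 8 + 7 * (y / wallRate y ^ 2) ^ 9)) =
      y ^ 6 * wallRate y ^ 2 * (1 - K) := by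
    rw [hK]
    field_simp
    ring
  have h1 : 1 - K ≤ a + b := by linarith
  have h2 : y ^ 6 * wallRate y ^ 2 * (1 - K) ≤ y ^ 6 * wallRate y ^ 2 * (a + b) :=
    mul_le_mul_of_nonneg_left h1 (by positivity)
  linarith

/-! ### §2  The tail is negligible at order seven: `y⁶ β² τ(y) → 0` -/

/-- ★ The envelope part of the tail: `y⁷ · (μ² + y^{2/3}/μ²)θ₃/(1 − θ₃) · θ₃^{11} → 0` (`θ₃ = μ²/y^{2/3}`; the product is
`μ^{22} · (1 + μ⁴/y^{2/3})/(1 − μ²/y^{2/3}) · y^{−1/3}`). [cite: MadrasSlade1993, Section 4.2, remark before (4.2.21) (p. 94)] -/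
theorem tendsto_pow_seven_mul_envelope_tail :
    Tendsto (fun y : ℝ => y ^ 7 *
      ((hexConnectiveConstant ^ 2 + y ^ ((2 : ℝ) / 3) / hexConnectiveConstant ^ 2) *
          (hexConnectiveConstant ^ 2 / y ^ ((2 : ℝ) / 3)) / (1 - hexConnectiveConstant ^ 2 / y ^ ((2 : ℝ) / 3)) *
          (hexConnectiveConstant ^ 2 / y ^ ((2 : ℝ) / 3)) ^ 11)) atTop (𝓝 0) := by
  have hμ := hexConnectiveConstant_pos
  have hs : Tendsto (fun y : ℝ => y ^ ((2 : ℝ) / 3)) atTop atTop := tendsto_rpow_atTop (by norm_num)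
  have hc : Tendsto (fun y : ℝ => (y ^ ((1 : ℝ) / 3))⁻¹) atTop (𝓝 0) := (tendsto_rpow_atTop (by norm_num)).inv_tendsto_atTop
  have hA : Tendsto (fun y : ℝ => (hexConnectiveConstant ^ 4 / y ^ ((2 : ℝ) / 3) + 1) /
      (1 - hexConnectiveConstant ^ 2 / y ^ ((2 : ℝ) / 3))) atTop (𝓝 ((0 + 1) / (1 - 0))) :=
    ((tendsto_const_nhds.div_atTop hs).add tendsto_const_nhds).div
      (tendsto_const_nhds.sub (tendsto_const_nhds.div_atTop hs)) (by norm_num)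
  have h := (hA.const_mul (hexConnectiveConstant ^ 22)).mul hc
  rw [show hexConnectiveConstant ^ 22 * ((0 + 1) / (1 - 0)) * (0 : ℝ) = 0 by ring] at h
  refine h.congr' ?_
  filter_upwards [eventually_gt_atTop (hexConnectiveConstant ^ 3)] with y hy
  have hy0 : 0 < y := lt_of_le_of_lt (by positivity) hy
  have hs0 : 0 < y ^ ((2 : ℝ) / 3) := Real.rpow_pos_of_pos hy0 _
  have hc0 : 0 < y ^ ((1 : ℝ) / 3) := Real.rpow_pos_of_pos hy0 _
  have hθ := theta_cube_lt_one hy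
  have hD : 1 - hexConnectiveConstant ^ 2 / y ^ ((2 : ℝ) / 3) ≠ 0 := by linarith
  have hD' : y ^ ((2 : ℝ) / 3) - hexConnectiveConstant ^ 2 ≠ 0 := by
    intro h0
    apply hD
    rw [sub_eq_zero] at h0
    rw [← h0, div_self hs0.ne', sub_self]
  rw [div_pow, ← pow_mul, show 2 * 11 = 22 by norm_num, rpow_two_thirds_pow_eleven_sve hy0]
  field_simp

/-- ★ The crude-count part of the tail: `y⁷ · (3^{18}y/β^{18} + 3^{20}(y + y²)/β^{20} + 3^{22}(y + y² + y³)/β^{22}) → 0`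
(`= 3^{18}r⁹/y + 3^{20}r^{10}(1/y² + 1/y) + 3^{22}r^{11}(1/y³ + 1/y² + 1/y)`, `r = y/β² → 1`).
[cite: BeatonBousquetMelouDeGierDuminilCopinGuttmann2014, Section 3.1, Proposition 5 (arXiv v5 p. 9)] -/
theorem tendsto_pow_seven_mul_crude_tail :
    Tendsto (fun y : ℝ => y ^ 7 * (3 ^ 18 * y / wallRate y ^ 18 + (3 ^ 20 * y + 3 ^ 20 * y ^ 2) / wallRate y ^ 20 +
      3 ^ 22 * (y + y ^ 2 + y ^ 3) / wallRate y ^ 22)) atTop (𝓝 0) := by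
  have hr := tendsto_div_sq_wallRate_sve
  have hu : Tendsto (fun y : ℝ => y⁻¹) atTop (𝓝 0) := tendsto_inv_atTop_zero
  have h := ((((hr.pow 9).const_mul ((3 : ℝ) ^ 18)).mul hu).add
    (((hr.pow 10).const_mul ((3 : ℝ) ^ 20)).mul ((hu.pow 2).add hu))).add
    (((hr.pow 11).const_mul ((3 : ℝ) ^ 22)).mul (((hu.pow 3).add (hu.pow 2)).add hu))
  rw [show (3 : ℝ) ^ 18 * 1 ^ 9 * 0 + 3 ^ 20 * 1 ^ 10 * (0 ^ 2 + 0) + 3 ^ 22 * 1 ^ 11 * (0 ^ 3 + 0 ^ 2 + 0) = 0 by norm_num] at h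
  refine h.congr' ?_
  filter_upwards [eventually_gt_atTop (0 : ℝ)] with y hy
  have hB : wallRate y ≠ 0 := (wallRate_pos y).ne'
  have hy' : y ≠ 0 := hy.ne'
  field_simp

/-- ★★ **The whole tail is negligible at order seven**: `y⁶ β(y)² τ(y) → 0`, `τ` the tail of «KESTEN-HEAD-SEVEN» ed.2
(`y⁶β²τ = (β²/y) · (y⁷τ)`, `β²/y → 1`). [cite: MadrasSlade1993, Section 4.2, Theorem 4.2.2 (pp. 91–92)] [cite: BeatonBousquetMelouDeGierDuminilCopinGuttmann2014, Section 3.1, Proposition 5 (arXiv v5 p. 9)] -/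
theorem tendsto_pow_six_mul_sq_wallRate_mul_tail :
    Tendsto (fun y : ℝ => y ^ 6 * wallRate y ^ 2 *
      ((hexConnectiveConstant ^ 2 + y ^ ((2 : ℝ) / 3) / hexConnectiveConstant ^ 2) *
            (hexConnectiveConstant ^ 2 / y ^ ((2 : ℝ) / 3)) / (1 - hexConnectiveConstant ^ 2 / y ^ ((2 : ℝ) / 3)) *
            (hexConnectiveConstant ^ 2 / y ^ ((2 : ℝ) / 3)) ^ 11 +
        (3 ^ 18 * y / wallRate y ^ 18 + (3 ^ 20 * y + 3 ^ 20 * y ^ 2) / wallRate y ^ 20 +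
          3 ^ 22 * (y + y ^ 2 + y ^ 3) / wallRate y ^ 22))) atTop (𝓝 0) := by
  have h := tendsto_sq_wallRate_div_sve.mul (tendsto_pow_seven_mul_envelope_tail.add tendsto_pow_seven_mul_crude_tail)
  rw [add_zero, mul_zero] at h
  refine h.congr' ?_
  filter_upwards [eventually_gt_atTop (0 : ℝ)] with y hy
  have hy' : y ≠ 0 := hy.ne'
  field_simp

/-! ### §3  The seventh order is exact: `a₆ = 12` -/

/-- ★★★ **THE SEVENTH-ORDER COEFFICIENT OF `β(y)²` IS EXACTLY TWELVE:**
`y⁶ (β(y)² − y − 1/y − 1/y² − 2/y³ − 4/y⁴ − 6/y⁵) → 12` as `y → ∞`, i.e.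
`β(y)² = y + 1/y + 1/y² + 2/y³ + 4/y⁴ + 6/y⁵ + 12/y⁶ + o(y⁻⁶)` — the lower half is «SEVENTH-FLOOR» (Kesten's identity over the 122
exhibited irreducible positive wall bridges with `s − v ≤ 7`, 79 of them on the diagonal `s − v = 7`, and the exact orders one to four),
the upper half §1–§2 (the COMPLETENESS of that census by the six-step law, «SEVEN-CENSUS» and «KESTEN-HEAD-SEVEN» ed.2 on `y > μ³`).  In the census bookkeeping:
`a₆ = N₈₁ + N₉₂ + N₁₀,₃ − 67 = 38 + 34 + 7 − 67 = 12`.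
[cite: BeatonBousquetMelouDeGierDuminilCopinGuttmann2014, Section 3.1, Proposition 5 (arXiv v5 p. 9); p. 10 (first-order remark)] [cite: Kesten1963SAW, Section 4] [cite: MadrasSlade1993, Section 4.2, (4.2.4), Theorem 4.2.2 (pp. 91–92)] -/
theorem tendsto_pow_six_mul_wallRate_sq_sub :
    Tendsto (fun y : ℝ => y ^ 6 * (wallRate y ^ 2 - y - 1 / y - 1 / y ^ 2 - 2 / y ^ 3 - 4 / y ^ 4 - 6 / y ^ 5)) atTop (𝓝 12) := by
  have hup := tendsto_seventh_order_lower.add tendsto_pow_six_mul_sq_wallRate_mul_tail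
  rw [add_zero] at hup
  refine tendsto_of_tendsto_of_tendsto_of_le_of_le' tendsto_seventh_order_lower hup ?_ ?_
  · filter_upwards [eventually_gt_atTop (hexConnectiveConstant ^ 4)] with y hy using seventh_order_lower hy
  · filter_upwards [eventually_gt_atTop (hexConnectiveConstant ^ 3)] with y hy using seventh_order_upper_of_cube_lt hy

/-- ★★★ The same in Landau form: `β(y)² − (y + 1/y + 1/y² + 2/y³ + 4/y⁴ + 6/y⁵ + 12/y⁶) = o(y⁻⁶)` as `y → ∞`.
[cite: BeatonBousquetMelouDeGierDuminilCopinGuttmann2014, Section 3.1, Proposition 5 (arXiv v5 p. 9)] -/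
theorem isLittleO_wallRate_sq_sub_seventh :
    (fun y : ℝ => wallRate y ^ 2 - (y + 1 / y + 1 / y ^ 2 + 2 / y ^ 3 + 4 / y ^ 4 + 6 / y ^ 5 + 12 / y ^ 6)) =o[atTop]
      fun y : ℝ => 1 / y ^ 6 := by
  have h0 : Tendsto (fun y : ℝ => y ^ 6 * (wallRate y ^ 2 - y - 1 / y - 1 / y ^ 2 - 2 / y ^ 3 - 4 / y ^ 4 - 6 / y ^ 5) - 12)
      atTop (𝓝 0) := by
    simpa using tendsto_pow_six_mul_wallRate_sq_sub.sub_const 12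
  have h1 : (fun y : ℝ => y ^ 6 * (wallRate y ^ 2 - y - 1 / y - 1 / y ^ 2 - 2 / y ^ 3 - 4 / y ^ 4 - 6 / y ^ 5) - 12) =o[atTop]
      fun _ : ℝ => (1 : ℝ) := (isLittleO_one_iff ℝ).2 h0
  have h2 := h1.mul_isBigO (isBigO_refl (fun y : ℝ => 1 / y ^ 6) atTop)
  refine (h2.congr' ?_ ?_)
  · filter_upwards [eventually_gt_atTop (0 : ℝ)] with y hy
    field_simp
    ring
  · exact Eventually.of_forall fun y => by simp

/-- ★★ Two-sided eventual form: for every `δ > 0`, eventually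
`y + 1/y + 1/y² + 2/y³ + 4/y⁴ + 6/y⁵ + (12 − δ)/y⁶ ≤ β(y)² ≤ y + 1/y + 1/y² + 2/y³ + 4/y⁴ + 6/y⁵ + (12 + δ)/y⁶`.
[cite: BeatonBousquetMelouDeGierDuminilCopinGuttmann2014, Section 3.1, Proposition 5 (arXiv v5 p. 9)] -/
theorem eventually_seventh_order_window {δ : ℝ} (hδ : 0 < δ) :
    ∀ᶠ y : ℝ in atTop, y + 1 / y + 1 / y ^ 2 + 2 / y ^ 3 + 4 / y ^ 4 + 6 / y ^ 5 + (12 - δ) / y ^ 6 ≤ wallRate y ^ 2 ∧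
      wallRate y ^ 2 ≤ y + 1 / y + 1 / y ^ 2 + 2 / y ^ 3 + 4 / y ^ 4 + 6 / y ^ 5 + (12 + δ) / y ^ 6 := by
  have h := tendsto_pow_six_mul_wallRate_sq_sub
  have hhi := h.eventually (eventually_lt_nhds (show (12 : ℝ) < 12 + δ by linarith))
  filter_upwards [eventually_seventh_order_floor hδ, hhi, eventually_gt_atTop (0 : ℝ)] with y h1 h2 hy
  refine ⟨h1, ?_⟩
  have hy6 : 0 < y ^ 6 := pow_pos hy 6
  have e2 : wallRate y ^ 2 = (y + 1 / y + 1 / y ^ 2 + 2 / y ^ 3 + 4 / y ^ 4 + 6 / y ^ 5) +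
      (y ^ 6 * (wallRate y ^ 2 - y - 1 / y - 1 / y ^ 2 - 2 / y ^ 3 - 4 / y ^ 4 - 6 / y ^ 5)) / y ^ 6 := by
    field_simp
    ring
  have e : y + 1 / y + 1 / y ^ 2 + 2 / y ^ 3 + 4 / y ^ 4 + 6 / y ^ 5 + (12 + δ) / y ^ 6 =
      (y + 1 / y + 1 / y ^ 2 + 2 / y ^ 3 + 4 / y ^ 4 + 6 / y ^ 5) + (12 + δ) / y ^ 6 := by ring
  rw [e, e2]
  gcongr

/-- ★ Uniqueness form (the converse of «SEVENTH-FLOOR»'s `twelve_le_of_tendsto_pow_six_mul_wallRate_sq_sub`): any limit of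
`y⁶ (β(y)² − y − 1/y − 1/y² − 2/y³ − 4/y⁴ − 6/y⁵)` equals `12`. [cite: MadrasSlade1993, Section 4.2, Theorem 4.2.2 (pp. 91–92)] -/
theorem tendsto_pow_six_mul_wallRate_sq_sub_unique {L : ℝ}
    (h : Tendsto (fun y : ℝ => y ^ 6 * (wallRate y ^ 2 - y - 1 / y - 1 / y ^ 2 - 2 / y ^ 3 - 4 / y ^ 4 - 6 / y ^ 5)) atTop (𝓝 L)) :
    L = 12 :=
  tendsto_nhds_unique h tendsto_pow_six_mul_wallRate_sq_sub

end Literature.Probability.RandomPlanarGeometry.SAW.HexBW.Wall
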